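import Summits.AtomisticToContinuum.HydrodynamicLimit.Theses.ImplosionDichotomy

/-!
# Crux `DiluteSelfConsistency` (stmt-AtomisticToContinuum-3091) — ideator 3, round 1: typed aids for the census

No idea card is filed by this seat (see `POSITIVE-CENSUS-i3.md`): every positive lever reduces to Melnikov
sign-rigidity at the quantised implosion profiles, which is numerically dead (crux dir `DenseExcursion`).
This file only records, kernel-checked, the η-BAND STRUCTURE of the crux that the census and the refuter's
route-review note (evidence 2026-08-16T19:12Z on this item) use:

* `DSCAt η` — dilute self-consistency at ONE band;
* `diluteSelfConsistency_iff` — the crux is `∀ η > 0, DSCAt η` (definitional);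
* `DSCAt.mono` — bands are upward closed, so a dense-excursion witness at `η_DE` refutes exactly the bands
  `η ≤ η_DE` and the crux, while `DSCAt η₀` for `η₀ > η_DE` stays logically open;
* `diluteSelfConsistency_of_seq` — the crux is its own `η → 0⁺` germ (it suffices on any sequence of bands
  tending to `0`), i.e. its whole content sits at arbitrarily SMALL packing, inside the certified analyticity
  range of the equation of state — exactly where the tuned-implosion mechanism operates.
-/

noncomputable section

namespace Summit.AtomisticToContinuum.HydrodynamicLimit.Cruxes.DiluteSelfConsistency.IdeatorThree

open Set Filter Topology
open Literature.MathematicalPhysics.KineticTheory Literature.Analysis.FluidPDE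
open Summit.AtomisticToContinuum.HydrodynamicLimit.Theses.ImplosionDichotomy

/-- Dilute self-consistency AT ONE BAND `η`: for all continuous positive profiles there is `σ₀` such
that for `0 < σ < σ₀` every admissible classical hard-sphere-Euler solution keeps packing `< η`. -/
def DSCAt (η : ℝ) : Prop :=
  ∀ (a₀ θ₀ : T3 → ℝ) (u₀ : T3 → V3), Continuous a₀ → Continuous θ₀ → Continuous u₀ →
    (∀ x, 0 < a₀ x) → (∀ x, 0 < θ₀ x) →
    ∃ σ₀ : ℝ, 0 < σ₀ ∧ ∀ σ : ℝ, 0 < σ → σ < σ₀ →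
      ∀ (T : ℝ) (ρ θ : ℝ → T3 → ℝ) (u : ℝ → T3 → V3), IsHardSphereEulerSolution σ T ρ u θ →
        ∀ Φ : (N : ℕ) → HardSphereFlow (Torus.geometry (Fin 3)) (hsDiameter σ N) (N + 1),
          TendstoHydroFieldsAt (fun N => localGibbsLaw σ a₀ u₀ θ₀ N (Φ N)) Φ ρ u θ 0 →
            ∀ t ∈ Ico 0 T, ∀ x, ρ t x * σ ^ 3 < η

/-- The crux is the conjunction of all its bands (definitional unfolding). -/
theorem diluteSelfConsistency_iff : DiluteSelfConsistency ↔ ∀ η : ℝ, 0 < η → DSCAt η := Iff.rfl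

/-- Bands are upward closed. -/
theorem DSCAt.mono {η η' : ℝ} (hle : η ≤ η') (h : DSCAt η) : DSCAt η' := by
  intro a₀ θ₀ u₀ ha hθ hu ha0 hθ0
  obtain ⟨σ₀, hσ₀, H⟩ := h a₀ θ₀ u₀ ha hθ hu ha0 hθ0
  exact ⟨σ₀, hσ₀, fun σ hσ hσ' T ρ θ u hE Φ h0 t ht x =>
    (H σ hσ hσ' T ρ θ u hE Φ h0 t ht x).trans_le hle⟩

/-- A non-positive band is empty of content only in the sense that it is FALSE as soon as one admissible
classical solution exists; we record the trivial direction used by the census: a band `η ≤ 0` fails at any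
profile carrying an admissible solution with `T > 0` (densities are positive). -/
theorem not_DSCAt_of_nonpos {η : ℝ} (hη : η ≤ 0)
    (hex : ∃ (a₀ θ₀ : T3 → ℝ) (u₀ : T3 → V3), Continuous a₀ ∧ Continuous θ₀ ∧ Continuous u₀ ∧
      (∀ x, 0 < a₀ x) ∧ (∀ x, 0 < θ₀ x) ∧ ∀ σ₀ : ℝ, 0 < σ₀ → ∃ σ : ℝ, 0 < σ ∧ σ < σ₀ ∧
        ∃ (T : ℝ) (ρ θ : ℝ → T3 → ℝ) (u : ℝ → T3 → V3), 0 < T ∧ IsHardSphereEulerSolution σ T ρ u θ ∧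
          ∃ Φ : (N : ℕ) → HardSphereFlow (Torus.geometry (Fin 3)) (hsDiameter σ N) (N + 1),
            TendstoHydroFieldsAt (fun N => localGibbsLaw σ a₀ u₀ θ₀ N (Φ N)) Φ ρ u θ 0) :
    ¬ DSCAt η := by
  intro h
  obtain ⟨a₀, θ₀, u₀, ha, hθ, hu, ha0, hθ0, hall⟩ := hex
  obtain ⟨σ₀, hσ₀, H⟩ := h a₀ θ₀ u₀ ha hθ hu ha0 hθ0
  obtain ⟨σ, hσ, hσ', T, ρ, θ, u, hT, hE, Φ, h0⟩ := hall σ₀ hσ₀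
  obtain ⟨x⟩ : Nonempty T3 := inferInstance
  have hlt := H σ hσ hσ' T ρ θ u hE Φ h0 0 ⟨le_rfl, hT⟩ x
  have hpos : 0 < ρ 0 x * σ ^ 3 := mul_pos (hE.density_pos 0 ⟨le_rfl, hT⟩ x) (pow_pos hσ 3)
  linarith

/-- The crux is its own `η → 0⁺` germ: proving it on any sequence of bands tending to `0` suffices. -/
theorem diluteSelfConsistency_of_seq (ηs : ℕ → ℝ)
    (hlim : Tendsto ηs atTop (𝓝 0)) (h : ∀ n, DSCAt (ηs n)) : DiluteSelfConsistency := by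
  intro η hη
  obtain ⟨n, hn⟩ := (hlim.eventually (eventually_lt_nhds hη)).exists
  exact DSCAt.mono hn.le (h n)

/-- Conversely the crux gives every positive band. -/
theorem DSCAt.of_diluteSelfConsistency (h : DiluteSelfConsistency) {η : ℝ} (hη : 0 < η) : DSCAt η :=
  h η hη

end Summit.AtomisticToContinuum.HydrodynamicLimit.Cruxes.DiluteSelfConsistency.IdeatorThree

end
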